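import Summits.ResolutionOfSingularities.ResolutionOfSingularities.Theses.AbhyankarShadows
import Literature.AlgebraicGeometry.Resolution.LocalUniformizationClosedPoints
import HarnessLib

/-!
# `AbhyankarShadows.RationalSuffices` (stmt-ResolutionOfSingularities-16758) — PROVED

Route `ResolutionOfSingularities/AbhyankarShadows`, support item `RationalSuffices` (rank 9):
over an algebraically closed field `k` of characteristic `p`, relative local uniformization for
RATIONAL valuation rings (every element of `O` congruent to a constant of `k` modulo the maximal
ideal) of all finitely generated `K/k` implies it for ALL valuation rings `O ⊇ k` of all such `K`.

Proof: the tree's `Literature.AlgebraicGeometry.Resolution.relLU_of_relLU_zeroDim`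
(closed points of the Zariski–Riemann space suffice: Serre's theorem + Zariski's lemma) reduces
to ZERO-DIMENSIONAL valuation rings (every `x ∈ O` is a root modulo `𝔪_O` of a non-zero
polynomial over `k`), and over an algebraically closed `k` zero-dimensional means rational
(`exists_valuation_sub_algebraMap_lt_one`: a non-zero `f ∈ k[X]` with `f(x) ∈ 𝔪_O` factors as
`(X - c) · g` with `c ∈ k`; either `x - c ∈ 𝔪_O` or `g(x) ∈ 𝔪_O`, and constants are units).
-/

-- single-problem summit: the doubled namespace component `ResolutionOfSingularities` is forced
set_option linter.dupNamespace false

namespace Summit.ResolutionOfSingularities.ResolutionOfSingularities.Theorems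

open Polynomial

/-- **Non-zero constants of the ground field are units of valuation `1`.** If the valuation ring
`O` of `K` contains (the image of) the field `k` and `c ∈ k` is non-zero, then
`v_O(c) = 1`: both `c` and `c⁻¹` lie in `O`. [folklore] -/
theorem valuation_algebraMap_eq_one {k K : Type} [Field k] [Field K] [Algebra k K]
    (O : ValuationSubring K) (hO : ∀ c : k, algebraMap k K c ∈ O) {c : k} (hc : c ≠ 0) :
    O.valuation (algebraMap k K c) = 1 := by
  apply le_antisymm ((O.valuation_le_one_iff _).mpr (hO c))
  have hne : O.valuation (algebraMap k K c) ≠ 0 := by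
    rw [Valuation.ne_zero_iff]
    exact (map_ne_zero (algebraMap k K)).mpr hc
  have hinv : (O.valuation (algebraMap k K c))⁻¹ ≤ 1 := by
    rw [← map_inv₀, ← map_inv₀]
    exact (O.valuation_le_one_iff _).mpr (hO c⁻¹)
  exact (inv_le_one₀ (zero_lt_iff.mpr hne)).mp hinv

/-- **Zero-dimensional is rational over an algebraically closed field** (degree-bounded form).
Let `k` be algebraically closed, `O` a valuation ring of `K` containing `k`, `x ∈ K`. If some
non-zero `f ∈ k[X]` of degree `≤ n` has `v_O(f(x)) < 1`, then `v_O(x - c) < 1` for some `c ∈ k`.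
Induction on `n`: `f = (X - c) · g` for a root `c` of `f` (`IsAlgClosed.exists_root`); if
`v_O(x - c) ≥ 1` then `v_O(g(x)) < 1` and `deg g < deg f`; constants have valuation `1`.
[folklore] -/
theorem exists_valuation_sub_algebraMap_lt_one_of_natDegree_le {k K : Type} [Field k] [Field K]
    [Algebra k K] [IsAlgClosed k] (O : ValuationSubring K) (hO : ∀ c : k, algebraMap k K c ∈ O)
    (x : K) : ∀ (n : ℕ) (f : Polynomial k), f.natDegree ≤ n → f ≠ 0 →
      O.valuation (Polynomial.aeval x f) < 1 → ∃ c : k, O.valuation (x - algebraMap k K c) < 1 := by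
  intro n
  induction n with
  | zero =>
    intro f hdeg hf0 hlt
    exfalso
    have hfC : f = C (f.coeff 0) := eq_C_of_natDegree_le_zero hdeg
    have hne : f.coeff 0 ≠ 0 := by
      intro h0
      apply hf0
      rw [hfC, h0, map_zero]
    rw [hfC, aeval_C, valuation_algebraMap_eq_one O hO hne] at hlt
    exact lt_irrefl _ hlt
  | succ n ih =>
    intro f hdeg hf0 hlt
    by_cases hd : f.natDegree = 0
    · exact ih f (hd.le.trans (Nat.zero_le n)) hf0 hlt
    · have hdeg0 : f.degree ≠ 0 := fun h =>
        hd (natDegree_eq_zero_iff_degree_le_zero.mpr h.le)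
      obtain ⟨c, hc⟩ := IsAlgClosed.exists_root f hdeg0
      set g : Polynomial k := f /ₘ (X - C c) with hg
      have hfg : (X - C c) * g = f := mul_divByMonic_eq_iff_isRoot.mpr hc
      have hg0 : g ≠ 0 := by
        intro h0
        apply hf0
        rw [← hfg, h0, mul_zero]
      have hgdeg : g.natDegree ≤ n := by
        have h1 : f.natDegree = 1 + g.natDegree := by
          rw [← hfg, natDegree_mul (X_sub_C_ne_zero c) hg0, natDegree_X_sub_C]
        omega
      have hval : O.valuation (aeval x f) =
          O.valuation (x - algebraMap k K c) * O.valuation (aeval x g) := by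
        rw [← hfg, map_mul, map_sub, aeval_X, aeval_C, map_mul]
      by_cases hxc : O.valuation (x - algebraMap k K c) < 1
      · exact ⟨c, hxc⟩
      · refine ih g hgdeg hg0 ?_
        by_contra hge
        push Not at hxc hge
        exact absurd hlt (not_lt.mpr (hval ▸ one_le_mul hxc hge))

/-- **Zero-dimensional valuation rings over an algebraically closed field are rational.** Let
`k` be algebraically closed and `O` a valuation ring of `K` containing `k`. If `x ∈ K` is a root
modulo `𝔪_O` of a non-zero polynomial over `k` (`f ≠ 0`, `f(x) ∈ O.nonunits`), then `x` is
congruent to a constant: `v_O(x - c) < 1` for some `c ∈ k`. (Zariski–Samuel II, Ch. VI §17: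
the residue field of a zero-dimensional valuation of `K/k` is algebraic over `k`, hence equal to
`k` when `k = k̄`.) [folklore] -/
theorem exists_valuation_sub_algebraMap_lt_one {k K : Type} [Field k] [Field K] [Algebra k K]
    [IsAlgClosed k] (O : ValuationSubring K) (hO : ∀ c : k, algebraMap k K c ∈ O) (x : K)
    (h : ∃ f : Polynomial k, f ≠ 0 ∧ Polynomial.aeval x f ∈ O.nonunits) :
    ∃ c : k, O.valuation (x - algebraMap k K c) < 1 := by
  obtain ⟨f, hf0, hf⟩ := h
  exact exists_valuation_sub_algebraMap_lt_one_of_natDegree_le O hO x f.natDegree f le_rfl hf0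
    (O.mem_nonunits_iff.mp hf)

/-- **`AbhyankarShadows.RationalSuffices` holds** (stmt-ResolutionOfSingularities-16758): over an
algebraically closed field `k` of characteristic `p`, relative local uniformization at RATIONAL
valuation rings of every finitely generated `K/k` implies relative local uniformization at EVERY
valuation ring `O ⊇ k` of every such `K`. Proof: `relLU_of_relLU_zeroDim` (closed points of the
Zariski–Riemann space suffice) and zero-dimensional `=` rational over `k = k̄`
(`exists_valuation_sub_algebraMap_lt_one`). [cite: ZariskiSamuel1960, Ch. VI §17] -/
theorem rationalSuffices_proof :
    Summit.ResolutionOfSingularities.ResolutionOfSingularities.Theses.AbhyankarShadows.RationalSuffices := by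
  unfold Theses.AbhyankarShadows.RationalSuffices
  intro p _hp k _ _ _ hrat K _ _ hfg O _hO R hRfg hRO
  refine Literature.AlgebraicGeometry.Resolution.relLU_of_relLU_zeroDim (k := k) (K := K)
    (fun O' hO' hzero R' hR'fg hR'O' => ?_) O R hRfg hRO
  exact hrat K hfg O' hO'
    (fun x hx => exists_valuation_sub_algebraMap_lt_one O' hO' x (hzero x hx)) R' hR'fg hR'O'

end Summit.ResolutionOfSingularities.ResolutionOfSingularities.Theorems
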